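import Summits.QuantumFields.BalabanUV.Beta.GAN24.StaircasePairs

/-!
# `BalabanUV.Beta.GAN24.StaircasePairing` — binder row G-an2-4 / (CONV-C), CT-ROUTE (owner's design `gen17/CT-ROUTE-v1.md`, refined `gen18/CT3-MECHANISM.md`
# v1.1 §(b)), STEP CT-3b2b: THE TWO-GAUGE ∕ DRESSED-PARTNER PAIRING OF TWO STAIRCASE SUMS IS BOUNDED WITHOUT A `log N` —
# «differentiate the COARSER factor» summed over the scale pairs

NOT IN PRINT; OUR PROOF ATTEMPT (row owner `b2b-balaban-gan24-p1`, gen 18; journal `CLAIMS.log` INTENT «CT-3b» l.31278).  [folklore] bookkeeping over CT-3b2a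
`GAN24/StaircasePairs` (the two per-pair bounds) — finite double sums exchanged with the lattice sum, a case split per pair, two geometric sums; 0 cited facts,
0 `def`, 0 `def … : Prop`, 0 sorry.  HONEST FRAMING (cell contract, verbatim): «discharging `BetaPertH` makes Bałaban's UV stability UNCONDITIONAL — a real
constructive-QFT result; it is NOT the continuum limit and NOT the Clay problem.»  HONEST DEPENDENCY (verbatim): «continuum YM on T⁴ ⇐ BetaPertH ∧ nine spine
estimates (0/9 proved); BetaPertH ⇐ (D1) ∧ (D4) ∧ CAP+tail; G-an2-4 gates asym, D1 and NE2/3/4.»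

## The statement (CT3-MECHANISM v1.1 §(b))
`t` a 1-form with `|t κ u| ≤ τ·E₀ u`, `t = 𝒬ᵀ_N φ` with `|φ κ y| ≤ Φ₀ e^{−κ₀‖y − y₀‖∞}`; two STAIRCASE SUMS `ψ u = Σ_{s≤k} G₁ s (blk (Lc^s) u)`, `χ u = Σ_{s≤k} G₂ s (blk (Lc^s) u)`
with per-scale envelopes `|G₁ s (blk (Lc^s) u)| ≤ a s·E₁ u`, `|G₂ s (blk (Lc^s) u)| ≤ b s·E₂ u`, every scale dividing the envelope block `N` (`Lc^s ∣ N`, `s ≤ k`),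
`E = E₀E₁E₂` summable.  Then (§2 **`abs_pairing_le_sum`**)
`|Σ'_u t κ u·½(ψ u + ψ(u+e_κ))·(χ(u+e_κ) − χ u)| ≤ [Σ_{s₁,s₂ ≤ k} w(s₁,s₂)]·Σ'E`, `w(s₁,s₂) = 2e^{2κ₀}τ·a s₁·b s₂·(Lc^{s₂})⁻¹` if `s₁ ≤ s₂` (differentiate the coarser `χ`-piece:
`abs_pair_le_of_blockConst_diff`) and `2e^{5κ₀}(Φ₀ + τ(Lc^{s₁})⁻¹)·a s₁·b s₂` if `s₂ < s₁` (sum by parts, differentiate the coarser `ψ`-piece: `abs_pair_le_of_blockConst_avg`);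
and (§3 **`abs_pairing_le_of_geometric`**) for geometric letters `a s ≤ α·Lc^s`, `b s ≤ β·Lc^s` (`2 ≤ Lc`) the weight sum is `≤ 8e^{5κ₀}·αβ·Lc^k·(2τ + Φ₀·Lc^k)` — LINEAR in
the top scale `Lc^k`, NOT `k·Lc^k`: the crude count (`Σ_{s₁,s₂} a s₁·b s₂·(Lc^{s₂})⁻¹` with the derivative always on `χ`) would give `(k+1)·Σ_s a s`, a `log N`.
In CT-3c's units (`a s, b s ≈ C·Lc·Lc^s·N^{−(D+1)}` from leaf-01's per-level letters, `τ = N·Φ₀e^{κ₀}`, `Φ₀ = C_Φ N^{−(D+5)}` (d4-p3's I1), `N = Lc^{k+1}`, `Σ'E ≤ N^D·Zl·e^{−κ′spread}`)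
this is the MAIN term's order `N^{−2D−4}`, uniformly in `k`.
Discharges NO slot letter; asserts NO shape of Bałaban's stencils; 0 wall binders; NEVER «G-an2-4 closed»; NOT D1, NOT BetaPertH, NOT continuum, NOT Clay.
-/

noncomputable section

open Finset
open scoped BigOperators
open Literature.MathematicalPhysics.QuantumFieldTheory
open Literature.MathematicalPhysics.QuantumFieldTheory.LatticeForm (quo)
open Literature.MathematicalPhysics.QuantumFieldTheory.Balaban1983to89
open Literature.MathematicalPhysics.QuantumFieldTheory.Balaban1983to89.Beta
open B4ContourShift (supNorm supNorm_nonneg)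
open AffineAveraging (Form0 Form1 Site unitVec)
open AffineReproduction (contourSumAdj)
open AveragingContours (blk)
open Summit.QuantumFields.BalabanUV.Beta.GAN24.StaircasePairs (abs_pair_le_of_blockConst_diff abs_pair_le_of_blockConst_avg)

namespace Summit.QuantumFields.BalabanUV.Beta.GAN24.StaircasePairing

variable {d : ℕ}

/-! ## §1 The pairing splits over the scale pairs -/

/-- [folklore] Pointwise: the pairing summand of two finite sums of pieces is the double sum of the piece pairings. -/
theorem summand_eq_sum_sum {k : ℕ} (t : Form1 (d + 1) ℝ) (lams mus : ℕ → Form0 (d + 1) ℝ) (κ : Fin (d + 1)) (u : Site (d + 1)) :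
    t κ u * ((∑ s ∈ Finset.range (k + 1), lams s u + ∑ s ∈ Finset.range (k + 1), lams s (u + unitVec κ)) / 2)
        * (∑ s ∈ Finset.range (k + 1), mus s (u + unitVec κ) - ∑ s ∈ Finset.range (k + 1), mus s u)
      = ∑ s₁ ∈ Finset.range (k + 1), ∑ s₂ ∈ Finset.range (k + 1),
          t κ u * ((lams s₁ u + lams s₁ (u + unitVec κ)) / 2) * (mus s₂ (u + unitVec κ) - mus s₂ u) := by
  rw [← Finset.sum_add_distrib, ← Finset.sum_sub_distrib, Finset.sum_div, Finset.mul_sum, Finset.mul_sum]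
  simp_rw [Finset.sum_mul]
  rw [Finset.sum_comm]

/-! ## §2 The weight of a scale pair and the bound -/

section Main

variable {N Lc k : ℕ} [NeZero N] {κ₀ τ Φ₀ : ℝ} {y₀ c₁ c₂ : Site (d + 1)} {φ : Form1 (d + 1) ℝ} {G₁ G₂ : ℕ → Form0 (d + 1) ℝ} {a b : ℕ → ℝ}

/-- NOT IN PRINT; OUR PROOF ATTEMPT (CT3-MECHANISM v1.1 §(b); [folklore] bookkeeping over `StaircasePairs`).
**THE PAIRING OF TWO STAIRCASE SUMS AGAINST THE TENT FORCE, SCALE PAIR BY SCALE PAIR, DERIVATIVE ON THE COARSER PIECE**: with `t = 𝒬ᵀ_N φ`,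
`|φ κ y| ≤ Φ₀e^{−κ₀‖y−y₀‖∞}`, `|t κ u| ≤ τE₀ u`, pieces `|G₁ s (blk (Lc^s) u)| ≤ a s·E₁ u`, `|G₂ s (blk (Lc^s) u)| ≤ b s·E₂ u` (`s ≤ k`), `Lc^s ∣ N` (`s ≤ k`), `1 ≤ Lc`,
`E = E₀E₁E₂` summable:
`|Σ'_u t κ u·½(ψ u + ψ(u+e_κ))·(χ(u+e_κ) − χ u)| ≤ (Σ_{s₁ ≤ k} Σ_{s₂ ≤ k} w s₁ s₂)·Σ'E`,
`w s₁ s₂ = if s₁ ≤ s₂ then 2e^{2κ₀}·τ·a s₁·b s₂·(Lc^{s₂})⁻¹ else 2e^{5κ₀}·(Φ₀ + τ·(Lc^{s₁})⁻¹)·a s₁·b s₂`. -/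
theorem abs_pairing_le_sum (hκ : 0 ≤ κ₀) (hτ : 0 ≤ τ) (hΦ : 0 ≤ Φ₀) (hLc : 1 ≤ Lc) (ha : ∀ s, 0 ≤ a s) (hb : ∀ s, 0 ≤ b s)
    (hdvd : ∀ s, s ≤ k → Lc ^ s ∣ N)
    (hφ : ∀ κ y, |φ κ y| ≤ Φ₀ * Real.exp (-(κ₀ * supNorm (y - y₀))))
    (ht : ∀ κ u, |contourSumAdj N φ κ u| ≤ τ * Real.exp (-(κ₀ * supNorm (quo N u - y₀))))
    (hG₁ : ∀ s, s ≤ k → ∀ u, |G₁ s (blk (Lc ^ s) u)| ≤ a s * Real.exp (-(κ₀ * supNorm (quo N u - c₁))))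
    (hG₂ : ∀ s, s ≤ k → ∀ u, |G₂ s (blk (Lc ^ s) u)| ≤ b s * Real.exp (-(κ₀ * supNorm (quo N u - c₂))))
    (hE : Summable fun u : Site (d + 1) => Real.exp (-(κ₀ * supNorm (quo N u - y₀))) * Real.exp (-(κ₀ * supNorm (quo N u - c₁))) *
      Real.exp (-(κ₀ * supNorm (quo N u - c₂))))
    {ψ χ : Form0 (d + 1) ℝ} (hψ : ∀ u, ψ u = ∑ s ∈ Finset.range (k + 1), G₁ s (blk (Lc ^ s) u))
    (hχ : ∀ u, χ u = ∑ s ∈ Finset.range (k + 1), G₂ s (blk (Lc ^ s) u)) (κ : Fin (d + 1)) :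
    |∑' u, contourSumAdj N φ κ u * ((ψ u + ψ (u + unitVec κ)) / 2) * (χ (u + unitVec κ) - χ u)|
      ≤ (∑ s₁ ∈ Finset.range (k + 1), ∑ s₂ ∈ Finset.range (k + 1),
          (if s₁ ≤ s₂ then 2 * Real.exp (2 * κ₀) * τ * a s₁ * b s₂ * (((Lc : ℝ) ^ s₂))⁻¹
           else 2 * Real.exp (5 * κ₀) * (Φ₀ + τ * (((Lc : ℝ) ^ s₁))⁻¹) * a s₁ * b s₂)) *
        ∑' u : Site (d + 1), Real.exp (-(κ₀ * supNorm (quo N u - y₀))) * Real.exp (-(κ₀ * supNorm (quo N u - c₁))) *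
          Real.exp (-(κ₀ * supNorm (quo N u - c₂))) := by
  set S : ℝ := ∑' u : Site (d + 1), Real.exp (-(κ₀ * supNorm (quo N u - y₀))) * Real.exp (-(κ₀ * supNorm (quo N u - c₁))) *
          Real.exp (-(κ₀ * supNorm (quo N u - c₂))) with hS
  set t := contourSumAdj N φ with htdef
  -- the piece pairings
  set F : ℕ → ℕ → Site (d + 1) → ℝ := fun s₁ s₂ u =>
    t κ u * ((G₁ s₁ (blk (Lc ^ s₁) u) + G₁ s₁ (blk (Lc ^ s₁) (u + unitVec κ))) / 2)
      * (G₂ s₂ (blk (Lc ^ s₂) (u + unitVec κ)) - G₂ s₂ (blk (Lc ^ s₂) u)) with hF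
  have hP : ∀ s, 1 ≤ Lc ^ s := fun s => Nat.one_le_pow _ _ (by omega)
  -- per pair: summable, and bounded by the weight times `S`
  have hpair : ∀ s₁ ∈ Finset.range (k + 1), ∀ s₂ ∈ Finset.range (k + 1),
      Summable (F s₁ s₂) ∧ |∑' u, F s₁ s₂ u| ≤
        (if s₁ ≤ s₂ then 2 * Real.exp (2 * κ₀) * τ * a s₁ * b s₂ * (((Lc : ℝ) ^ s₂))⁻¹
         else 2 * Real.exp (5 * κ₀) * (Φ₀ + τ * (((Lc : ℝ) ^ s₁))⁻¹) * a s₁ * b s₂) * S := by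
    intro s₁ hs₁ s₂ hs₂
    have hk₁ : s₁ ≤ k := Nat.lt_succ_iff.1 (Finset.mem_range.1 hs₁)
    have hk₂ : s₂ ≤ k := Nat.lt_succ_iff.1 (Finset.mem_range.1 hs₂)
    by_cases hle : s₁ ≤ s₂
    · -- the χ-piece (differentiated) is the coarser one: (i)
      rw [if_pos hle]
      have h := abs_pair_le_of_blockConst_diff (N := N) (y₀ := y₀) (c₁ := c₁) (c₂ := c₂) hκ hτ (ha s₁) (hb s₂) (hP s₂) (hdvd s₂ hk₂)
        (t := t) (lam := fun u => G₁ s₁ (blk (Lc ^ s₁) u)) (g := G₂ s₂) ht (hG₁ s₁ hk₁) (hG₂ s₂ hk₂) hE κ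
      refine ⟨h.1, h.2.trans (le_of_eq ?_)⟩
      push_cast; ring
    · -- the ψ-piece (averaged) is the coarser one: (ii), by parts
      rw [if_neg hle]
      have h := abs_pair_le_of_blockConst_avg (N := N) (y₀ := y₀) (c₁ := c₁) (c₂ := c₂) hκ hτ hΦ (ha s₁) (hb s₂) (hP s₁) (hdvd s₁ hk₁)
        (φ := φ) (g := G₁ s₁) (m := fun u => G₂ s₂ (blk (Lc ^ s₂) u)) hφ ht (hG₁ s₁ hk₁) (hG₂ s₂ hk₂) hE κ
      refine ⟨h.1, h.2.trans (le_of_eq ?_)⟩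
      push_cast; ring
  -- the pairing is the double sum of the piece pairings
  have hsummand : ∀ u, t κ u * ((ψ u + ψ (u + unitVec κ)) / 2) * (χ (u + unitVec κ) - χ u)
      = ∑ s₁ ∈ Finset.range (k + 1), ∑ s₂ ∈ Finset.range (k + 1), F s₁ s₂ u := by
    intro u
    rw [hψ u, hψ (u + unitVec κ), hχ u, hχ (u + unitVec κ)]
    exact summand_eq_sum_sum t (fun s u => G₁ s (blk (Lc ^ s) u)) (fun s u => G₂ s (blk (Lc ^ s) u)) κ u
  have hinner : ∀ s₁ ∈ Finset.range (k + 1), Summable fun u => ∑ s₂ ∈ Finset.range (k + 1), F s₁ s₂ u :=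
    fun s₁ hs₁ => summable_sum fun s₂ hs₂ => (hpair s₁ hs₁ s₂ hs₂).1
  rw [tsum_congr hsummand, Summable.tsum_finsetSum hinner]
  rw [Finset.sum_congr rfl fun s₁ hs₁ => Summable.tsum_finsetSum fun s₂ hs₂ => (hpair s₁ hs₁ s₂ hs₂).1, Finset.sum_mul]
  refine (Finset.abs_sum_le_sum_abs _ _).trans (Finset.sum_le_sum fun s₁ hs₁ => ?_)
  rw [Finset.sum_mul]
  exact (Finset.abs_sum_le_sum_abs _ _).trans (Finset.sum_le_sum fun s₂ hs₂ => (hpair s₁ hs₁ s₂ hs₂).2)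

end Main

/-! ## §3 The geometric double sum: no `log N` -/

/-- [folklore] `Σ_{s ≤ k} L^s ≤ 2·L^k` for `2 ≤ L`. -/
theorem sum_pow_le {L : ℝ} (hL : 2 ≤ L) (k : ℕ) : ∑ s ∈ Finset.range (k + 1), L ^ s ≤ 2 * L ^ k := by
  have hL1 : 1 < L := by linarith
  rw [geom_sum_eq hL1.ne' (k + 1), div_le_iff₀ (by linarith), pow_succ]
  nlinarith [pow_pos (by linarith : (0 : ℝ) < L) k]

/-- [folklore] The truncated lower-triangular sums: `Σ_{s₁ ≤ k, s₁ ≤ s₂} L^{s₁} ≤ 2·L^{s₂}` (`2 ≤ L`). -/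
theorem sum_ite_le_pow_le {L : ℝ} (hL : 2 ≤ L) (k s₂ : ℕ) :
    ∑ s₁ ∈ Finset.range (k + 1), (if s₁ ≤ s₂ then L ^ s₁ else 0) ≤ 2 * L ^ s₂ := by
  have hL0 : 0 ≤ L := by linarith
  rw [← Finset.sum_filter]
  calc ∑ s₁ ∈ (Finset.range (k + 1)).filter (fun s₁ => s₁ ≤ s₂), L ^ s₁ ≤ ∑ s₁ ∈ Finset.range (s₂ + 1), L ^ s₁ := by
        refine Finset.sum_le_sum_of_subset_of_nonneg (fun s₁ hs₁ => ?_) (fun _ _ _ => by positivity)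
        rw [Finset.mem_filter, Finset.mem_range] at hs₁
        exact Finset.mem_range.2 (by omega)
    _ ≤ 2 * L ^ s₂ := sum_pow_le hL s₂

/-- [folklore] … and `Σ_{s₂ ≤ k, ¬ s₁ ≤ s₂} L^{s₂} ≤ 2·L^{s₁}`. -/
theorem sum_ite_lt_pow_le {L : ℝ} (hL : 2 ≤ L) (k s₁ : ℕ) :
    ∑ s₂ ∈ Finset.range (k + 1), (if s₁ ≤ s₂ then 0 else L ^ s₂) ≤ 2 * L ^ s₁ := by
  have hL0 : 0 ≤ L := by linarith
  have e : ∀ s₂, (if s₁ ≤ s₂ then (0 : ℝ) else L ^ s₂) = if s₂ < s₁ then L ^ s₂ else 0 := by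
    intro s₂
    by_cases h : s₁ ≤ s₂
    · rw [if_pos h, if_neg (not_lt.2 h)]
    · rw [if_neg h, if_pos (not_le.1 h)]
  simp only [e]
  rw [← Finset.sum_filter]
  calc ∑ s₂ ∈ (Finset.range (k + 1)).filter (fun s₂ => s₂ < s₁), L ^ s₂ ≤ ∑ s₂ ∈ Finset.range (s₁ + 1), L ^ s₂ := by
        refine Finset.sum_le_sum_of_subset_of_nonneg (fun s₂ hs₂ => ?_) (fun _ _ _ => by positivity)
        rw [Finset.mem_filter, Finset.mem_range] at hs₂
        exact Finset.mem_range.2 (by omega)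
    _ ≤ 2 * L ^ s₁ := sum_pow_le hL s₁

/-- NOT IN PRINT; OUR PROOF ATTEMPT (CT3-MECHANISM v1.1 §(b) (iii); [folklore]).
**THE WEIGHT SUM FOR GEOMETRIC PER-SCALE LETTERS IS LINEAR IN THE TOP SCALE** (`2 ≤ Lc`, `a s ≤ α·Lc^s`, `b s ≤ β·Lc^s`, all letters `≥ 0`):
`Σ_{s₁,s₂ ≤ k} w s₁ s₂ ≤ 8e^{5κ₀}·α·β·Lc^k·(2τ + Φ₀·Lc^k)` — NOT `(k+1)·Lc^k`: the pairs `s₁ ≤ s₂` weigh `≤ 2e^{5κ₀}ταβ·Lc^{s₁}` (`Σ_{s₁ ≤ s₂} Lc^{s₁} ≤ 2Lc^{s₂}`,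
`Σ_{s₂} 2Lc^{s₂} ≤ 4Lc^k`), the pairs `s₂ < s₁` weigh `≤ 2e^{5κ₀}αβ(τLc^{s₂} + Φ₀Lc^{s₁}Lc^{s₂})` (`Σ_{s₂<s₁} ≤ 2Lc^{s₁}`, `Σ_{s₁} ≤ 4Lc^k` resp. `4Lc^{2k}`).
The crude count with the derivative always on `χ` would instead be `Σ_{s₁,s₂} a s₁ b s₂ (Lc^{s₂})⁻¹ ≈ (k+1)·αβ·Σ_s Lc^s` — a `log N`. -/
theorem sum_weights_le_of_geometric {Lc k : ℕ} (hLc : 2 ≤ Lc) {κ₀ τ Φ₀ α β : ℝ} (hκ : 0 ≤ κ₀) (hτ : 0 ≤ τ) (hΦ : 0 ≤ Φ₀) (hα : 0 ≤ α) (hβ : 0 ≤ β)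
    {a b : ℕ → ℝ} (ha : ∀ s, 0 ≤ a s) (hb : ∀ s, 0 ≤ b s) (haL : ∀ s, a s ≤ α * (Lc : ℝ) ^ s) (hbL : ∀ s, b s ≤ β * (Lc : ℝ) ^ s) :
    (∑ s₁ ∈ Finset.range (k + 1), ∑ s₂ ∈ Finset.range (k + 1),
        (if s₁ ≤ s₂ then 2 * Real.exp (2 * κ₀) * τ * a s₁ * b s₂ * (((Lc : ℝ) ^ s₂))⁻¹
         else 2 * Real.exp (5 * κ₀) * (Φ₀ + τ * (((Lc : ℝ) ^ s₁))⁻¹) * a s₁ * b s₂))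
      ≤ 8 * Real.exp (5 * κ₀) * α * β * (Lc : ℝ) ^ k * (2 * τ + Φ₀ * (Lc : ℝ) ^ k) := by
  have hL : (2 : ℝ) ≤ (Lc : ℝ) := by exact_mod_cast hLc
  have hL0 : (0 : ℝ) < (Lc : ℝ) := by linarith
  have h25 : Real.exp (2 * κ₀) ≤ Real.exp (5 * κ₀) := Real.exp_le_exp.2 (by nlinarith)
  set C : ℝ := 2 * Real.exp (5 * κ₀) * α * β with hC
  have hC0 : 0 ≤ C := by positivity
  -- per pair: the majorant `Cτ·[s₁≤s₂]·Lc^{s₁} + Cτ·[s₂<s₁]·Lc^{s₂} + CΦ₀·[s₂<s₁]·Lc^{s₁}·Lc^{s₂}`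
  have hpairle : ∀ s₁ s₂ : ℕ,
      (if s₁ ≤ s₂ then 2 * Real.exp (2 * κ₀) * τ * a s₁ * b s₂ * (((Lc : ℝ) ^ s₂))⁻¹
         else 2 * Real.exp (5 * κ₀) * (Φ₀ + τ * (((Lc : ℝ) ^ s₁))⁻¹) * a s₁ * b s₂)
        ≤ C * τ * (if s₁ ≤ s₂ then (Lc : ℝ) ^ s₁ else 0) + C * τ * (if s₁ ≤ s₂ then 0 else (Lc : ℝ) ^ s₂)
            + C * Φ₀ * ((Lc : ℝ) ^ s₁ * (if s₁ ≤ s₂ then 0 else (Lc : ℝ) ^ s₂)) := by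
    intro s₁ s₂
    have hab : a s₁ * b s₂ ≤ (α * (Lc : ℝ) ^ s₁) * (β * (Lc : ℝ) ^ s₂) := mul_le_mul (haL s₁) (hbL s₂) (hb s₂) (by positivity)
    have hab0 : 0 ≤ a s₁ * b s₂ := mul_nonneg (ha s₁) (hb s₂)
    have hLs₁ : (0 : ℝ) < (Lc : ℝ) ^ s₁ := pow_pos hL0 _
    have hLs₂ : (0 : ℝ) < (Lc : ℝ) ^ s₂ := pow_pos hL0 _
    split_ifs with hle
    · rw [mul_zero, mul_zero, mul_zero, add_zero, add_zero]
      have hq : a s₁ * b s₂ * (((Lc : ℝ) ^ s₂))⁻¹ ≤ α * β * (Lc : ℝ) ^ s₁ := by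
        rw [← div_eq_mul_inv, div_le_iff₀ hLs₂]; nlinarith
      have hq0 : 0 ≤ a s₁ * b s₂ * (((Lc : ℝ) ^ s₂))⁻¹ := by positivity
      calc 2 * Real.exp (2 * κ₀) * τ * a s₁ * b s₂ * ((Lc : ℝ) ^ s₂)⁻¹ = (2 * Real.exp (2 * κ₀) * τ) * (a s₁ * b s₂ * ((Lc : ℝ) ^ s₂)⁻¹) := by ring
        _ ≤ (2 * Real.exp (5 * κ₀) * τ) * (α * β * (Lc : ℝ) ^ s₁) := mul_le_mul (by nlinarith) hq hq0 (by positivity)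
        _ = C * τ * (Lc : ℝ) ^ s₁ := by rw [hC]; ring
    · rw [mul_zero, zero_add]
      have hq1 : (((Lc : ℝ) ^ s₁))⁻¹ * (a s₁ * b s₂) ≤ α * β * (Lc : ℝ) ^ s₂ := by
        rw [← div_eq_inv_mul, div_le_iff₀ hLs₁]; nlinarith
      have hq2 : Φ₀ * (a s₁ * b s₂) ≤ Φ₀ * (α * β * ((Lc : ℝ) ^ s₁ * (Lc : ℝ) ^ s₂)) := mul_le_mul_of_nonneg_left (by nlinarith) hΦ
      have hτq : τ * ((((Lc : ℝ) ^ s₁))⁻¹ * (a s₁ * b s₂)) ≤ τ * (α * β * (Lc : ℝ) ^ s₂) := mul_le_mul_of_nonneg_left hq1 hτ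
      calc 2 * Real.exp (5 * κ₀) * (Φ₀ + τ * ((Lc : ℝ) ^ s₁)⁻¹) * a s₁ * b s₂
          = 2 * Real.exp (5 * κ₀) * (Φ₀ * (a s₁ * b s₂) + τ * ((((Lc : ℝ) ^ s₁))⁻¹ * (a s₁ * b s₂))) := by ring
        _ ≤ 2 * Real.exp (5 * κ₀) * (Φ₀ * (α * β * ((Lc : ℝ) ^ s₁ * (Lc : ℝ) ^ s₂)) + τ * (α * β * (Lc : ℝ) ^ s₂)) :=
            mul_le_mul_of_nonneg_left (add_le_add hq2 hτq) (by positivity)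
        _ = C * τ * (Lc : ℝ) ^ s₂ + C * Φ₀ * ((Lc : ℝ) ^ s₁ * (Lc : ℝ) ^ s₂) := by rw [hC]; ring
  -- the three majorant sums
  have hT1 : ∑ s₁ ∈ Finset.range (k + 1), ∑ s₂ ∈ Finset.range (k + 1), (if s₁ ≤ s₂ then (Lc : ℝ) ^ s₁ else 0) ≤ 4 * (Lc : ℝ) ^ k := by
    rw [Finset.sum_comm]
    calc ∑ s₂ ∈ Finset.range (k + 1), ∑ s₁ ∈ Finset.range (k + 1), (if s₁ ≤ s₂ then (Lc : ℝ) ^ s₁ else 0)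
        ≤ ∑ s₂ ∈ Finset.range (k + 1), 2 * (Lc : ℝ) ^ s₂ := Finset.sum_le_sum fun s₂ _ => sum_ite_le_pow_le hL k s₂
      _ ≤ 4 * (Lc : ℝ) ^ k := by rw [← Finset.mul_sum]; nlinarith [sum_pow_le hL k]
  have hT2 : ∑ s₁ ∈ Finset.range (k + 1), ∑ s₂ ∈ Finset.range (k + 1), (if s₁ ≤ s₂ then 0 else (Lc : ℝ) ^ s₂) ≤ 4 * (Lc : ℝ) ^ k := by
    calc ∑ s₁ ∈ Finset.range (k + 1), ∑ s₂ ∈ Finset.range (k + 1), (if s₁ ≤ s₂ then 0 else (Lc : ℝ) ^ s₂)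
        ≤ ∑ s₁ ∈ Finset.range (k + 1), 2 * (Lc : ℝ) ^ s₁ := Finset.sum_le_sum fun s₁ _ => sum_ite_lt_pow_le hL k s₁
      _ ≤ 4 * (Lc : ℝ) ^ k := by rw [← Finset.mul_sum]; nlinarith [sum_pow_le hL k]
  have hT3 : ∑ s₁ ∈ Finset.range (k + 1), ∑ s₂ ∈ Finset.range (k + 1), ((Lc : ℝ) ^ s₁ * (if s₁ ≤ s₂ then 0 else (Lc : ℝ) ^ s₂))
      ≤ 4 * ((Lc : ℝ) ^ k * (Lc : ℝ) ^ k) := by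
    have hL2 : (2 : ℝ) ≤ (Lc : ℝ) ^ 2 := by nlinarith
    calc ∑ s₁ ∈ Finset.range (k + 1), ∑ s₂ ∈ Finset.range (k + 1), ((Lc : ℝ) ^ s₁ * (if s₁ ≤ s₂ then 0 else (Lc : ℝ) ^ s₂))
        = ∑ s₁ ∈ Finset.range (k + 1), (Lc : ℝ) ^ s₁ * ∑ s₂ ∈ Finset.range (k + 1), (if s₁ ≤ s₂ then 0 else (Lc : ℝ) ^ s₂) :=
          Finset.sum_congr rfl fun s₁ _ => by rw [Finset.mul_sum]
      _ ≤ ∑ s₁ ∈ Finset.range (k + 1), (Lc : ℝ) ^ s₁ * (2 * (Lc : ℝ) ^ s₁) :=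
          Finset.sum_le_sum fun s₁ _ => mul_le_mul_of_nonneg_left (sum_ite_lt_pow_le hL k s₁) (by positivity)
      _ = 2 * ∑ s₁ ∈ Finset.range (k + 1), ((Lc : ℝ) ^ 2) ^ s₁ := by
          rw [Finset.mul_sum]; exact Finset.sum_congr rfl fun s₁ _ => by rw [← pow_mul, mul_comm 2 s₁, pow_mul]; ring
      _ ≤ 2 * (2 * ((Lc : ℝ) ^ 2) ^ k) := by nlinarith [sum_pow_le hL2 k]
      _ = 4 * ((Lc : ℝ) ^ k * (Lc : ℝ) ^ k) := by rw [← pow_mul, mul_comm 2 k, pow_mul]; ring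
  -- assemble
  have hCτ : 0 ≤ C * τ := mul_nonneg hC0 hτ
  have hCΦ : 0 ≤ C * Φ₀ := mul_nonneg hC0 hΦ
  calc (∑ s₁ ∈ Finset.range (k + 1), ∑ s₂ ∈ Finset.range (k + 1),
        (if s₁ ≤ s₂ then 2 * Real.exp (2 * κ₀) * τ * a s₁ * b s₂ * (((Lc : ℝ) ^ s₂))⁻¹
         else 2 * Real.exp (5 * κ₀) * (Φ₀ + τ * (((Lc : ℝ) ^ s₁))⁻¹) * a s₁ * b s₂))
      ≤ ∑ s₁ ∈ Finset.range (k + 1), ∑ s₂ ∈ Finset.range (k + 1),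
          (C * τ * (if s₁ ≤ s₂ then (Lc : ℝ) ^ s₁ else 0) + C * τ * (if s₁ ≤ s₂ then 0 else (Lc : ℝ) ^ s₂)
            + C * Φ₀ * ((Lc : ℝ) ^ s₁ * (if s₁ ≤ s₂ then 0 else (Lc : ℝ) ^ s₂))) :=
        Finset.sum_le_sum fun s₁ _ => Finset.sum_le_sum fun s₂ _ => hpairle s₁ s₂
    _ = C * τ * ∑ s₁ ∈ Finset.range (k + 1), ∑ s₂ ∈ Finset.range (k + 1), (if s₁ ≤ s₂ then (Lc : ℝ) ^ s₁ else 0)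
        + C * τ * ∑ s₁ ∈ Finset.range (k + 1), ∑ s₂ ∈ Finset.range (k + 1), (if s₁ ≤ s₂ then 0 else (Lc : ℝ) ^ s₂)
        + C * Φ₀ * ∑ s₁ ∈ Finset.range (k + 1), ∑ s₂ ∈ Finset.range (k + 1), ((Lc : ℝ) ^ s₁ * (if s₁ ≤ s₂ then 0 else (Lc : ℝ) ^ s₂)) := by
        simp only [Finset.sum_add_distrib, Finset.mul_sum]
    _ ≤ C * τ * (4 * (Lc : ℝ) ^ k) + C * τ * (4 * (Lc : ℝ) ^ k) + C * Φ₀ * (4 * ((Lc : ℝ) ^ k * (Lc : ℝ) ^ k)) :=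
        add_le_add (add_le_add (mul_le_mul_of_nonneg_left hT1 hCτ) (mul_le_mul_of_nonneg_left hT2 hCτ)) (mul_le_mul_of_nonneg_left hT3 hCΦ)
    _ = 8 * Real.exp (5 * κ₀) * α * β * (Lc : ℝ) ^ k * (2 * τ + Φ₀ * (Lc : ℝ) ^ k) := by rw [hC]; ring

end Summit.QuantumFields.BalabanUV.Beta.GAN24.StaircasePairing

end
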